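import Summits.QuantumFields.QCD.Theses.HeatSlicedQuarks
import Summits.QuantumFields.QCD.Theorems.HeatSlicedQuarksQuarkLoopCoefficientDefs
import Summits.QuantumFields.QCD.Theorems.HeatSlicedQuarksQuarkLoopCoefficientHeatSeriesB

/-!
# Magnetic-translation covariance of the symmetric gauge (line `Sketch` of crux stmt-QuantumFields-16786)

For the symmetric-gauge `U(1)` field `symLink θ` on `ℤ⁴` (`A₀ = −z₁/2`, `A₁ = z₀/2`), translating both
arguments of any kernel of the theory by `v` multiplies it by the unit phase
`Ω_θ(v, y − x) = exp(i (θ/2) · v ∧ (y − x))`: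

* `symLink θ (z + v, μ) = exp(i θ A_μ(v)) · symLink θ (z, μ)` (linearity of the potential);
* `diracKer`, `sqKer`, `sqKerPow`, `heatKer` of `symLink θ` are covariant with the phase `Ω_θ(v, y − x)`;
* consequently `heatKer (symLink θ) t x y = Ω_θ(x, y − x) • symHeat θ t (y − x)`;
* the Dirac symbol at the origin is the free one, `diracKer (symLink θ) 0 w = dsymb w`, and the symbol of
  `H_θ = D♯D` is the twisted product `sqKer (symLink θ) 0 v = Σ_{z ∈ nbr 0} Ω_θ(z, v) • (dsharp z * dsymb (v − z))`;
* the evolution equations of the heat symbol `E_t = symHeat θ t` in twisted-convolution form: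
  `∂_t E_t(w) = −Σ_{v ∈ nbr2 0} Ω_θ(v, w) • ȟ_θ(v) * E_t(w − v) = −Σ_{v ∈ nbr2 w} Ω_θ(v, w) • E_t(v) * ȟ_θ(w − v)`.
-/

noncomputable section

namespace Summit.QuantumFields.QCD.Cruxes.QuarkLoopCoefficient.Sketch.SymmetricGauge

open Literature.MathematicalPhysics.QuantumLattice Literature.MathematicalPhysics.QuantumFieldTheory
open Literature.Probability.LatticeModels (Site)
open Summit.QuantumFields.QCD.Theorems.QuarkLoopCoefficient
open Summit.QuantumFields.QCD.Cruxes.QuarkLoopCoefficient.Sketch.HeatSeries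
open scoped Matrix ComplexConjugate

/-! ## §1 The cocycle -/

/-- The magnetic-translation phase `Ω_θ(v, w) = exp(i (θ/2) · v ∧ w)`. We write it out in statements; this
lemma records that it is a character in the second argument. -/
theorem cexp_wedge_add (θ : ℝ) (v w w' : Site 4) :
    Complex.exp (((θ / 2 * (wedge v (w + w') : ℤ) : ℝ) : ℂ) * Complex.I) =
      Complex.exp (((θ / 2 * (wedge v w : ℤ) : ℝ) : ℂ) * Complex.I) *
        Complex.exp (((θ / 2 * (wedge v w' : ℤ) : ℝ) : ℂ) * Complex.I) := by
  rw [← Complex.exp_add]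
  congr 1
  simp only [wedge, Pi.add_apply]
  push_cast
  ring

/-- `Ω_θ(v, 0) = 1`. -/
theorem cexp_wedge_zero (θ : ℝ) (v : Site 4) :
    Complex.exp (((θ / 2 * (wedge v 0 : ℤ) : ℝ) : ℂ) * Complex.I) = 1 := by
  simp [wedge]

/-- `Ω_θ(v, −w) = conj Ω_θ(v, w)`. -/
theorem cexp_wedge_neg (θ : ℝ) (v w : Site 4) :
    Complex.exp (((θ / 2 * (wedge v (-w) : ℤ) : ℝ) : ℂ) * Complex.I) =
      conj (Complex.exp (((θ / 2 * (wedge v w : ℤ) : ℝ) : ℂ) * Complex.I)) := by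
  rw [← Complex.exp_conj]
  congr 1
  simp only [wedge, Pi.neg_apply, map_mul, Complex.conj_ofReal, Complex.conj_I]
  push_cast
  ring

/-- The phase has modulus one. -/
theorem norm_cexp_wedge (θ : ℝ) (v w : Site 4) :
    ‖Complex.exp (((θ / 2 * (wedge v w : ℤ) : ℝ) : ℂ) * Complex.I)‖ = 1 :=
  Complex.norm_exp_ofReal_mul_I _

/-! ## §2 The symmetric-gauge links under translation -/

/-- The symmetric potential is additive in the site. -/
theorem symPotential_add (z v : Site 4) (μ : Fin 4) :
    symPotential (z + v) μ = symPotential z μ + symPotential v μ := by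
  unfold symPotential
  split_ifs <;> simp [Pi.add_apply] <;> ring

/-- Translating a symmetric-gauge link multiplies it by `exp(i θ A_μ(v))`. -/
theorem symLink_add (θ : ℝ) (z v : Site 4) (μ : Fin 4) :
    symLink θ (z + v, μ) = Complex.exp (((θ * symPotential v μ : ℝ) : ℂ) * Complex.I) * symLink θ (z, μ) := by
  unfold symLink
  rw [← Complex.exp_add, symPotential_add]
  congr 1; push_cast; ring

/-- The translation factor of a forward link is the cocycle at the unit vector: `exp(iθA_μ(v)) = Ω_θ(v, e_μ)`. -/
theorem cexp_symPotential_eq (θ : ℝ) (v : Site 4) (μ : Fin 4) :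
    Complex.exp (((θ * symPotential v μ : ℝ) : ℂ) * Complex.I) =
      Complex.exp (((θ / 2 * (wedge v (Pi.single μ 1) : ℤ) : ℝ) : ℂ) * Complex.I) := by
  congr 3
  unfold symPotential wedge
  fin_cases μ <;> simp <;> ring

/-- The symmetric-gauge links have modulus one. -/
theorem norm_symLink (θ : ℝ) (e : ZdEdge 4) : ‖symLink θ e‖ = 1 :=
  Complex.norm_exp_ofReal_mul_I _

/-- The symmetric-gauge links are bounded by one (hypothesis format of the series file). -/
theorem norm_symLink_le (θ : ℝ) : ∀ e : ZdEdge 4, ‖symLink θ e‖ ≤ 1 := fun e => (norm_symLink θ e).le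

/-- At the origin row the symmetric-gauge links entering `D(0, ·)` are trivial: forward links from `0`. -/
theorem symLink_zero (θ : ℝ) (μ : Fin 4) : symLink θ (0, μ) = 1 := by
  unfold symLink symPotential
  split_ifs <;> simp

/-- Backward links into `0`: `symLink θ (−e_μ, μ) = 1`. -/
theorem symLink_neg_single (θ : ℝ) (μ : Fin 4) : symLink θ (-Pi.single μ 1, μ) = 1 := by
  unfold symLink symPotential
  fin_cases μ <;> simp

/-! ## §3 Covariance of the kernels -/

/-- Two opposite unit steps cannot both relate the same pair of sites. -/
theorem not_fwd_and_bwd (x y : Site 4) (μ : Fin 4) :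
    ¬(y = x + Pi.single μ 1 ∧ x = y + Pi.single μ 1) := by
  rintro ⟨h1, h2⟩
  have : (Pi.single μ (1 : ℤ) + Pi.single μ 1 : Site 4) μ = (0 : Site 4) μ := by
    have e : x = x + Pi.single μ 1 + Pi.single μ 1 := by
      conv_lhs => rw [h2, h1]
    have : (Pi.single μ (1 : ℤ) + Pi.single μ 1 : Site 4) = 0 := by
      have := congrArg (fun z => z - x) e
      simpa [add_assoc] using this.symm
    rw [this]
  simp at this

/-- **Covariance of the Dirac kernel**: `D_θ(x + v, y + v) = Ω_θ(v, y − x) • D_θ(x, y)`. -/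
theorem diracKer_symLink_add (θ : ℝ) (x y v : Site 4) :
    diracKer (symLink θ) (x + v) (y + v) =
      Complex.exp (((θ / 2 * (wedge v (y - x) : ℤ) : ℝ) : ℂ) * Complex.I) • diracKer (symLink θ) x y := by
  have hxy : (x + v = y + v) ↔ (x = y) := ⟨add_right_cancel, fun h => by rw [h]⟩
  have hf : ∀ μ : Fin 4, (y + v = x + v + Pi.single μ 1) ↔ (y = x + Pi.single μ 1) := by
    intro μ; constructor
    · intro e; rw [add_right_comm] at e; exact add_right_cancel e
    · intro e; rw [e]; abel
  have hb : ∀ μ : Fin 4, (x + v = y + v + Pi.single μ 1) ↔ (x = y + Pi.single μ 1) := by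
    intro μ; constructor
    · intro e; rw [add_right_comm] at e; exact add_right_cancel e
    · intro e; rw [e]; abel
  unfold diracKer
  rw [smul_sub, smul_comm (Complex.exp _) (1 / 2 : ℂ)]
  congr 1
  · by_cases h : x = y
    · rw [if_pos (hxy.mpr h), if_pos h, h, sub_self, cexp_wedge_zero, one_smul]
    · rw [if_neg (fun e => h (hxy.mp e)), if_neg h, smul_zero]
  · congr 1
    rw [Finset.smul_sum]
    refine Finset.sum_congr rfl fun μ _ => ?_
    rw [smul_add (Complex.exp (((θ / 2 * (wedge v (y - x) : ℤ) : ℝ) : ℂ) * Complex.I))]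
    congr 1
    · by_cases h1 : y = x + Pi.single μ 1
      · rw [if_pos ((hf μ).mpr h1), if_pos h1, symLink_add, cexp_symPotential_eq, ← smul_smul]
        congr 2
        rw [h1, add_sub_cancel_left]
      · rw [if_neg (fun e => h1 ((hf μ).mp e)), if_neg h1, smul_zero]
    · by_cases h2 : x = y + Pi.single μ 1
      · rw [if_pos ((hb μ).mpr h2), if_pos h2, symLink_add, map_mul, cexp_symPotential_eq, ← smul_smul,
          ← cexp_wedge_neg]
        congr 2
        rw [h2]
        congr 4
        simp [wedge]
      · rw [if_neg (fun e => h2 ((hb μ).mp e)), if_neg h2, smul_zero]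

/-- `nbr (x + v) = (nbr x).map (+ v)`, in the membership form we need. -/
theorem mem_nbr_add {x v z : Site 4} : z ∈ nbr (x + v) ↔ z - v ∈ nbr x := by
  rw [mem_nbr, mem_nbr]
  constructor
  · rintro (h | ⟨μ, h | h⟩)
    · exact Or.inl (by rw [h]; abel)
    · exact Or.inr ⟨μ, Or.inl (by rw [h]; abel)⟩
    · exact Or.inr ⟨μ, Or.inr (by rw [h]; abel)⟩
  · rintro (h | ⟨μ, h | h⟩)
    · exact Or.inl (by rw [← sub_add_cancel z v, h])
    · exact Or.inr ⟨μ, Or.inl (by rw [← sub_add_cancel z v, h]; abel)⟩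
    · exact Or.inr ⟨μ, Or.inr (by rw [← sub_add_cancel z v, h]; abel)⟩

/-- **Covariance of the squared kernel**: `H_θ(x + v, y + v) = Ω_θ(v, y − x) • H_θ(x, y)`. -/
theorem sqKer_symLink_add (θ : ℝ) (x y v : Site 4) :
    sqKer (symLink θ) (x + v) (y + v) =
      Complex.exp (((θ / 2 * (wedge v (y - x) : ℤ) : ℝ) : ℂ) * Complex.I) • sqKer (symLink θ) x y := by
  unfold sqKer
  -- reindex the sum over `nbr (x+v)` by `z ↦ z - v`
  have hre : ∑ z ∈ nbr (x + v), (diracKer (symLink θ) z (x + v))ᴴ * diracKer (symLink θ) z (y + v) =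
      ∑ z ∈ nbr x, (diracKer (symLink θ) (z + v) (x + v))ᴴ * diracKer (symLink θ) (z + v) (y + v) := by
    refine Finset.sum_nbij' (fun z => z - v) (fun z => z + v) ?_ ?_ ?_ ?_ ?_
    · intro z hz; exact mem_nbr_add.mp hz
    · intro z hz; exact mem_nbr_add.mpr (by simpa using hz)
    · intro z _; simp
    · intro z _; simp
    · intro z _; simp
  rw [hre, Finset.smul_sum]
  refine Finset.sum_congr rfl fun z _ => ?_
  rw [diracKer_symLink_add, diracKer_symLink_add, Matrix.conjTranspose_smul, Matrix.smul_mul,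
    Matrix.mul_smul, smul_smul]
  congr 1
  -- star Ω(v, x − z) * Ω(v, y − z) = Ω(v, y − x)
  rw [Complex.star_def, ← cexp_wedge_neg, ← cexp_wedge_add]
  congr 4
  simp only [wedge, Pi.add_apply, Pi.neg_apply, Pi.sub_apply]
  ring

/-- `nbr2 (x + v)` in membership form. -/
theorem mem_nbr2_add {x v z : Site 4} : z ∈ nbr2 (x + v) ↔ z - v ∈ nbr2 x := by
  rw [mem_nbr2, mem_nbr2]
  constructor
  · rintro ⟨w, hw, hz⟩
    refine ⟨w - v, mem_nbr_add.mp hw, ?_⟩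
    exact mem_nbr_add.mp (by rwa [sub_add_cancel])
  · rintro ⟨w, hw, hz⟩
    refine ⟨w + v, mem_nbr_add.mpr (by simpa using hw), ?_⟩
    exact mem_nbr_add.mpr (by simpa using hz)

/-- **Covariance of the kernel powers**. -/
theorem sqKerPow_symLink_add (θ : ℝ) :
    ∀ (n : ℕ) (x y v : Site 4), sqKerPow (symLink θ) n (x + v) (y + v) =
      Complex.exp (((θ / 2 * (wedge v (y - x) : ℤ) : ℝ) : ℂ) * Complex.I) • sqKerPow (symLink θ) n x y := by
  intro n
  induction n with
  | zero =>
    intro x y v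
    simp only [sqKerPow_zero_apply]
    by_cases h : x = y
    · rw [if_pos (by rw [h]), if_pos h, h, sub_self, cexp_wedge_zero, one_smul]
    · have h' : x + v ≠ y + v := fun e => h (add_right_cancel e)
      rw [if_neg h', if_neg h, smul_zero]
  | succ n ih =>
    intro x y v
    rw [sqKerPow_succ, sqKerPow_succ]
    have hre : ∑ z ∈ nbr2 (x + v), sqKer (symLink θ) (x + v) z * sqKerPow (symLink θ) n z (y + v) =
        ∑ z ∈ nbr2 x, sqKer (symLink θ) (x + v) (z + v) * sqKerPow (symLink θ) n (z + v) (y + v) := by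
      refine Finset.sum_nbij' (fun z => z - v) (fun z => z + v) ?_ ?_ ?_ ?_ ?_
      · intro z hz; exact mem_nbr2_add.mp hz
      · intro z hz; exact mem_nbr2_add.mpr (by simpa using hz)
      · intro z _; simp
      · intro z _; simp
      · intro z _; simp
    rw [hre, Finset.smul_sum]
    refine Finset.sum_congr rfl fun z _ => ?_
    rw [sqKer_symLink_add, ih, Matrix.smul_mul, Matrix.mul_smul, smul_smul, ← cexp_wedge_add]
    congr 4
    simp only [wedge, Pi.add_apply, Pi.sub_apply]
    ring

/-- **Covariance of the heat kernel**. -/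
theorem heatKer_symLink_add (θ t : ℝ) (x y v : Site 4) :
    heatKer (symLink θ) t (x + v) (y + v) =
      Complex.exp (((θ / 2 * (wedge v (y - x) : ℤ) : ℝ) : ℂ) * Complex.I) • heatKer (symLink θ) t x y := by
  unfold heatKer
  rw [← (summable_heatKer_smul (norm_symLink_le θ) t x y).tsum_const_smul
    (Complex.exp (((θ / 2 * (wedge v (y - x) : ℤ) : ℝ) : ℂ) * Complex.I))]
  refine tsum_congr fun n => ?_
  rw [sqKerPow_symLink_add, smul_comm]

/-- The heat kernel of the symmetric gauge is the phase times the heat symbol of the displacement: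
`heatKer (symLink θ) t x y = Ω_θ(x, y − x) • symHeat θ t (y − x)`. -/
theorem heatKer_symLink_eq_symHeat (θ t : ℝ) (x y : Site 4) :
    heatKer (symLink θ) t x y =
      Complex.exp (((θ / 2 * (wedge x (y - x) : ℤ) : ℝ) : ℂ) * Complex.I) • symHeat θ t (y - x) := by
  unfold symHeat
  have := heatKer_symLink_add θ t 0 (y - x) x
  simp only [zero_add, sub_add_cancel, sub_zero] at this
  exact this

/-! ## §4 The symbols at the origin and the evolution equations -/

/-- The Dirac symbol of the symmetric gauge at the origin is the free one (its links there equal `1`). -/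
theorem diracKer_symLink_zero (θ : ℝ) (w : Site 4) : diracKer (symLink θ) 0 w = dsymb w := by
  unfold dsymb diracKer
  congr 1
  congr 1
  refine Finset.sum_congr rfl fun μ _ => ?_
  congr 1
  · split_ifs
    · rw [symLink_zero]
    · rfl
  · split_ifs with h
    · have hw : w = -Pi.single μ 1 := by
        have := congrArg (fun z => z - Pi.single μ 1) h; simpa using this.symm
      rw [hw, symLink_neg_single, map_one]
    · rfl

/-- The Dirac kernel into the origin, `D_θ(z, 0) = dsymb (−z)`. -/
theorem diracKer_symLink_to_zero (θ : ℝ) (z : Site 4) : diracKer (symLink θ) z 0 = dsymb (-z) := by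
  have := diracKer_symLink_add θ 0 (-z) z
  simp only [zero_add, neg_add_cancel, sub_zero] at this
  rw [this, diracKer_symLink_zero]
  have h0 : wedge z (-z) = 0 := by simp only [wedge, Pi.neg_apply]; ring
  simp [h0]

/-- **The symbol of `H_θ`**: `sqKer (symLink θ) 0 v = Σ_{z ∈ nbr 0} Ω_θ(z, v) • (dsharp z * dsymb (v − z))`. -/
theorem sqKer_symLink_zero (θ : ℝ) (v : Site 4) :
    sqKer (symLink θ) 0 v = ∑ z ∈ nbr 0,
      Complex.exp (((θ / 2 * (wedge z v : ℤ) : ℝ) : ℂ) * Complex.I) • (dsharp z * dsymb (v - z)) := by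
  unfold sqKer
  refine Finset.sum_congr rfl fun z _ => ?_
  rw [diracKer_symLink_to_zero]
  have hcov := diracKer_symLink_add θ 0 (v - z) z
  simp only [zero_add, sub_add_cancel, sub_zero] at hcov
  rw [hcov, diracKer_symLink_zero, Matrix.mul_smul]
  have hw : wedge z (v - z) = wedge z v := by simp [wedge]; ring
  rw [hw]
  rfl

/-- **Evolution equation of the heat symbol (left form)**:
`∂_t E_t(w) = −Σ_{v ∈ nbr2 0} Ω_θ(v, w) • ȟ_θ(v) * E_t(w − v)`, `ȟ_θ(v) = sqKer (symLink θ) 0 v`. -/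
theorem hasDerivAt_symHeat (θ t : ℝ) (w : Site 4) (α β : Fin 4) :
    HasDerivAt (fun s : ℝ => symHeat θ s w α β)
      (-(∑ v ∈ nbr2 0, Complex.exp (((θ / 2 * (wedge v w : ℤ) : ℝ) : ℂ) * Complex.I) •
          (sqKer (symLink θ) 0 v * symHeat θ t (w - v))) α β) t := by
  have h := hasDerivAt_heatKer_apply (norm_symLink_le θ) t 0 w α β
  have e : ∑ v ∈ nbr2 0, sqKer (symLink θ) 0 v * heatKer (symLink θ) t v w =
      ∑ v ∈ nbr2 0, Complex.exp (((θ / 2 * (wedge v w : ℤ) : ℝ) : ℂ) * Complex.I) •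
        (sqKer (symLink θ) 0 v * symHeat θ t (w - v)) := by
    refine Finset.sum_congr rfl fun v _ => ?_
    rw [heatKer_symLink_eq_symHeat, Matrix.mul_smul]
    have hw : wedge v (w - v) = wedge v w := by simp [wedge]; ring
    rw [hw]
  change HasDerivAt (fun s : ℝ => heatKer (symLink θ) s 0 w α β) _ t
  rw [← e]
  exact h

/-- **Evolution equation of the heat symbol (right form)**:
`∂_t E_t(w) = −Σ_{v ∈ nbr2 w} Ω_θ(v, w) • E_t(v) * ȟ_θ(w − v)`. -/
theorem hasDerivAt_symHeat_right (θ t : ℝ) (w : Site 4) (α β : Fin 4) :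
    HasDerivAt (fun s : ℝ => symHeat θ s w α β)
      (-(∑ v ∈ nbr2 w, Complex.exp (((θ / 2 * (wedge v w : ℤ) : ℝ) : ℂ) * Complex.I) •
          (symHeat θ t v * sqKer (symLink θ) 0 (w - v))) α β) t := by
  have h := hasDerivAt_heatKer_apply_right (norm_symLink_le θ) t 0 w α β
  have e : ∑ v ∈ nbr2 w, heatKer (symLink θ) t 0 v * sqKer (symLink θ) v w =
      ∑ v ∈ nbr2 w, Complex.exp (((θ / 2 * (wedge v w : ℤ) : ℝ) : ℂ) * Complex.I) •
        (symHeat θ t v * sqKer (symLink θ) 0 (w - v)) := by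
    refine Finset.sum_congr rfl fun v _ => ?_
    have hcov := sqKer_symLink_add θ 0 (w - v) v
    simp only [zero_add, sub_add_cancel, sub_zero] at hcov
    rw [hcov, Matrix.mul_smul]
    have hw : wedge v (w - v) = wedge v w := by simp [wedge]; ring
    rw [hw]
    rfl
  change HasDerivAt (fun s : ℝ => heatKer (symLink θ) s 0 w α β) _ t
  rw [← e]
  exact h

/-! ## Registered headline -/

/-- Registered headline of this helper file (aux stub `stub_symmetricGauge` of crux stmt-QuantumFields-16786, line
`Sketch`): the evolution equation of the symmetric-gauge heat symbol in twisted-convolution form. -/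
theorem stub_symmetricGauge :
    ∀ (θ t : ℝ) (w : Site 4) (α β : Fin 4),
      HasDerivAt (fun s : ℝ => symHeat θ s w α β)
        (-(∑ v ∈ nbr2 0, Complex.exp (((θ / 2 * (wedge v w : ℤ) : ℝ) : ℂ) * Complex.I) •
            (sqKer (symLink θ) 0 v * symHeat θ t (w - v))) α β) t :=
  hasDerivAt_symHeat

end Summit.QuantumFields.QCD.Cruxes.QuarkLoopCoefficient.Sketch.SymmetricGauge

end
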